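import Literature.Analysis.Complex.KoebeDistortion
import Mathlib.Analysis.Complex.UpperHalfPlane.Topology
import Mathlib.Analysis.Complex.Schwarz
import HarnessLib

/-!
# Koebe distortion for conformal maps of the upper half-plane

Trunk T-STOCH support (complex analysis). For `f` holomorphic and injective on the open upper
half-plane `ℍₒ` and `z ∈ ℍₒ`, the disc `B(z, im z)` lies in `ℍₒ`, so the Koebe distortion
theorem on a disc (`Literature.Analysis.Complex.AreaThm.distortion_half_ball`,
`Literature/Analysis/Complex/KoebeDistortion.lean`; Pommerenke (1992), Thm. 1.3) gives, for
`|w - z| ≤ im z / 2`,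

  `|f'(w)| ≤ 12 |f'(z)|`,  `(4/27) |f'(z)| ≤ |f'(w)|`,  `|f(w) - f(z)| ≤ 2 im z |f'(z)|`

(`distortion_upperHalfPlane`), and by chaining `n` such steps along a segment at height `≥ y`,
`|f'(w)| ≤ 12ⁿ |f'(z)|` whenever `im z, im w ≥ y` and `|w - z| ≤ n y / 2`
(`norm_deriv_le_pow_mul`; and `norm_sub_le_chain` for the increments). This is the estimate "`|f'(w)| ≤ 144^{|z-w|/y+1} |f'(z)|` for
`im z, im w ≥ y`" of Lawler, *Conformally Invariant Processes in the Plane* (2005), proof of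
Lemma 4.33, the deterministic part of Rohde–Schramm's Theorem 3.6. We also record the
Schwarz–Pick type bound `|f'(z)| ≤ 2 im f(z)/im z` for holomorphic `f : ℍₒ → ℍₒ`
(`norm_deriv_le_two_mul_im_div`, from Mathlib's Schwarz lemma
`Complex.norm_deriv_le_div_of_mapsTo_ball`).

## References

* Ch. Pommerenke, *Boundary Behaviour of Conformal Maps* (1992), Thm. 1.3, Cor. 1.5.
* G. F. Lawler, *Conformally Invariant Processes in the Plane* (2005), proof of Lemma 4.33.
-/

noncomputable section

open Set Filter Metric Topology Complex
open UpperHalfPlane (upperHalfPlaneSet isOpen_upperHalfPlaneSet)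

namespace Literature.Analysis.Complex

namespace AreaThm

variable {f : ℂ → ℂ}

/-- The disc `B(z, im z)` lies in the open upper half-plane. [folklore] -/
theorem ball_im_subset_upperHalfPlaneSet (z : ℂ) : ball z z.im ⊆ upperHalfPlaneSet := by
  intro w hw
  rw [mem_ball, dist_eq_norm] at hw
  have h := Complex.abs_im_le_norm (w - z)
  rw [Complex.sub_im] at h
  change 0 < w.im
  linarith [(abs_lt.1 (h.trans_lt hw)).1]

/-- **Koebe distortion in the half-plane, one step**: for `f` holomorphic and injective on `ℍₒ`,
`z ∈ ℍₒ` and `|w - z| ≤ im z / 2`: `|f'(w)| ≤ 12|f'(z)|`, `(4/27)|f'(z)| ≤ |f'(w)|`,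
`|f(w) - f(z)| ≤ 2 im z |f'(z)|`. [cite: PommerenkeBBCM1992, Thm. 1.3] -/
theorem distortion_upperHalfPlane (hf : DifferentiableOn ℂ f upperHalfPlaneSet)
    (hinj : InjOn f upperHalfPlaneSet) {z w : ℂ} (hz : 0 < z.im) (hw : ‖w - z‖ ≤ z.im / 2) :
    ‖deriv f w‖ ≤ 12 * ‖deriv f z‖ ∧ 4 / 27 * ‖deriv f z‖ ≤ ‖deriv f w‖ ∧
      ‖f w - f z‖ ≤ 2 * z.im * ‖deriv f z‖ :=
  distortion_half_ball hz (hf.mono (ball_im_subset_upperHalfPlaneSet z))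
    (hinj.mono (ball_im_subset_upperHalfPlaneSet z)) hw

/-- **Linear growth bound in the half-plane**: for `f` holomorphic and injective on `ℍₒ`,
`z ∈ ℍₒ` and `|w - z| ≤ im z / 2`, `|f(w) - f(z)| ≤ 4 |f'(z)| |w - z|` (Koebe growth on the disc
`B(z, im z)`: `ρ/(1-ρ)² ≤ 4ρ` for `ρ ≤ 1/2`). [cite: PommerenkeBBCM1992, Thm. 1.3] -/
theorem norm_sub_le_four_mul (hf : DifferentiableOn ℂ f upperHalfPlaneSet)
    (hinj : InjOn f upperHalfPlaneSet) {z w : ℂ} (hz : 0 < z.im) (hw : ‖w - z‖ ≤ z.im / 2) :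
    ‖f w - f z‖ ≤ 4 * ‖deriv f z‖ * ‖w - z‖ := by
  have hwb : w ∈ ball z z.im := by rw [mem_ball, dist_eq_norm]; linarith
  obtain ⟨-, -, h3⟩ := distortion_ball hz (hf.mono (ball_im_subset_upperHalfPlaneSet z))
    (hinj.mono (ball_im_subset_upperHalfPlaneSet z)) hwb
  set ρ : ℝ := ‖w - z‖ / z.im with hρ
  have hρ0 : 0 ≤ ρ := by positivity
  have hρ2 : ρ ≤ 1 / 2 := by rw [hρ, div_le_iff₀ hz]; linarith
  have hq : ρ / (1 - ρ) ^ 2 ≤ 4 * ρ := by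
    rw [div_le_iff₀ (by nlinarith)]
    nlinarith [mul_nonneg (mul_nonneg hρ0 (by linarith : (0:ℝ) ≤ 1 - 2 * ρ))
      (by linarith : (0:ℝ) ≤ 3 - 2 * ρ)]
  have hρz : z.im * ρ = ‖w - z‖ := by rw [hρ]; field_simp
  calc ‖f w - f z‖ ≤ ‖deriv f z‖ * z.im * (ρ / (1 - ρ) ^ 2) := h3
    _ ≤ ‖deriv f z‖ * z.im * (4 * ρ) := by gcongr
    _ = 4 * ‖deriv f z‖ * (z.im * ρ) := by ring
    _ = 4 * ‖deriv f z‖ * ‖w - z‖ := by rw [hρz]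

/-- **Chained distortion**: for `f` holomorphic and injective on `ℍₒ`, `y > 0`, points `z, w`
with `im z, im w ≥ y` and `|w - z| ≤ n y / 2` satisfy `|f'(w)| ≤ 12ⁿ |f'(z)|` (walk from `z` to
`w` in `n` equal steps; the segment stays at height `≥ y`). Lawler (2005), proof of Lemma 4.33
("`|f'(w)| ≤ 144^{(|z-w|/y)+1} |f'(z)|`"). [cite: Lawler2005, Lemma 4.33] -/
theorem norm_deriv_le_pow_mul (hf : DifferentiableOn ℂ f upperHalfPlaneSet)
    (hinj : InjOn f upperHalfPlaneSet) {y : ℝ} (hy : 0 < y) (n : ℕ) :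
    ∀ {z w : ℂ}, y ≤ z.im → y ≤ w.im → ‖w - z‖ ≤ n * y / 2 →
      ‖deriv f w‖ ≤ 12 ^ n * ‖deriv f z‖ := by
  induction n with
  | zero =>
    intro z w hz hw hzw
    have : w = z := by
      have h : ‖w - z‖ ≤ 0 := by simpa using hzw
      exact sub_eq_zero.1 (norm_le_zero_iff.1 h)
    simp [this]
  | succ n ih =>
    intro z w hz hw hzw
    -- the intermediate point at fraction `n/(n+1)` of the way
    set v : ℂ := z + ((n : ℝ) / (n + 1) : ℝ) * (w - z) with hv
    have hn1 : (0 : ℝ) < n + 1 := by positivity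
    have hvim : y ≤ v.im := by
      have : v.im = (1 - (n : ℝ) / (n + 1)) * z.im + ((n : ℝ) / (n + 1)) * w.im := by
        simp only [hv, Complex.add_im, Complex.mul_im, Complex.ofReal_re, Complex.ofReal_im,
          Complex.sub_im, zero_mul, add_zero]
        ring
      rw [this]
      have h1 : 0 ≤ (n : ℝ) / (n + 1) := by positivity
      have h2 : (n : ℝ) / (n + 1) ≤ 1 := by rw [div_le_one hn1]; linarith
      nlinarith
    have hvz : ‖v - z‖ ≤ n * y / 2 := by
      have : v - z = (((n : ℝ) / (n + 1) : ℝ) : ℂ) * (w - z) := by rw [hv]; ring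
      rw [this, norm_mul, Complex.norm_real, Real.norm_eq_abs, abs_of_nonneg (by positivity)]
      calc (n : ℝ) / (n + 1) * ‖w - z‖ ≤ (n : ℝ) / (n + 1) * ((n + 1 : ℕ) * y / 2) := by
            gcongr
        _ = n * y / 2 := by push_cast; field_simp
    have hwv : ‖w - v‖ ≤ v.im / 2 := by
      have : w - v = ((1 - (n : ℝ) / (n + 1) : ℝ) : ℂ) * (w - z) := by
        rw [hv]; push_cast; ring
      have h1n : 1 - (n : ℝ) / (n + 1) = 1 / (n + 1) := by field_simp; ring
      rw [this, norm_mul, Complex.norm_real, Real.norm_eq_abs, h1n, abs_of_nonneg (by positivity)]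
      calc 1 / ((n : ℝ) + 1) * ‖w - z‖ ≤ 1 / ((n : ℝ) + 1) * ((n + 1 : ℕ) * y / 2) := by
            gcongr
        _ = y / 2 := by push_cast; field_simp
        _ ≤ v.im / 2 := by linarith
    have hstep := (distortion_upperHalfPlane hf hinj (hy.trans_le hvim) hwv).1
    have hprev := ih hz hvim hvz
    calc ‖deriv f w‖ ≤ 12 * ‖deriv f v‖ := hstep
      _ ≤ 12 * (12 ^ n * ‖deriv f z‖) := by gcongr
      _ = 12 ^ (n + 1) * ‖deriv f z‖ := by ring

/-- **Chained growth bound**: under the hypotheses of `norm_deriv_le_pow_mul` and with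
`M ≥ im z, im w`, `|f(w) - f(z)| ≤ 2 M n 12ⁿ |f'(z)|` (each of the `n` steps contributes at most
`2 · (height) · |f'| ≤ 2 M 12ⁿ |f'(z)|`). [cite: Lawler2005, Lemma 4.33] -/
theorem norm_sub_le_chain (hf : DifferentiableOn ℂ f upperHalfPlaneSet)
    (hinj : InjOn f upperHalfPlaneSet) {y : ℝ} (hy : 0 < y) (n : ℕ) :
    ∀ {z w : ℂ} {M : ℝ}, y ≤ z.im → y ≤ w.im → z.im ≤ M → w.im ≤ M → ‖w - z‖ ≤ n * y / 2 →
      ‖f w - f z‖ ≤ 2 * M * n * 12 ^ n * ‖deriv f z‖ := by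
  induction n with
  | zero =>
    intro z w M hz hw _ _ hzw
    have : w = z := by
      have h : ‖w - z‖ ≤ 0 := by simpa using hzw
      exact sub_eq_zero.1 (norm_le_zero_iff.1 h)
    simp [this]
  | succ n ih =>
    intro z w M hz hw hzM hwM hzw
    set v : ℂ := z + ((n : ℝ) / (n + 1) : ℝ) * (w - z) with hv
    have hn1 : (0 : ℝ) < n + 1 := by positivity
    have hl0 : 0 ≤ (n : ℝ) / (n + 1) := by positivity
    have hl1 : (n : ℝ) / (n + 1) ≤ 1 := by rw [div_le_one hn1]; linarith
    have hvim_eq : v.im = (1 - (n : ℝ) / (n + 1)) * z.im + ((n : ℝ) / (n + 1)) * w.im := by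
      simp only [hv, Complex.add_im, Complex.mul_im, Complex.ofReal_re, Complex.ofReal_im,
        Complex.sub_im, zero_mul, add_zero]
      ring
    have hvim : y ≤ v.im := by rw [hvim_eq]; nlinarith
    have hvM : v.im ≤ M := by rw [hvim_eq]; nlinarith
    have hvz : ‖v - z‖ ≤ n * y / 2 := by
      have : v - z = (((n : ℝ) / (n + 1) : ℝ) : ℂ) * (w - z) := by rw [hv]; ring
      rw [this, norm_mul, Complex.norm_real, Real.norm_eq_abs, abs_of_nonneg hl0]
      calc (n : ℝ) / (n + 1) * ‖w - z‖ ≤ (n : ℝ) / (n + 1) * ((n + 1 : ℕ) * y / 2) := by gcongr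
        _ = n * y / 2 := by push_cast; field_simp
    have hwv : ‖w - v‖ ≤ v.im / 2 := by
      have : w - v = ((1 - (n : ℝ) / (n + 1) : ℝ) : ℂ) * (w - z) := by rw [hv]; push_cast; ring
      have h1n : 1 - (n : ℝ) / (n + 1) = 1 / (n + 1) := by field_simp; ring
      rw [this, norm_mul, Complex.norm_real, Real.norm_eq_abs, h1n, abs_of_nonneg (by positivity)]
      calc 1 / ((n : ℝ) + 1) * ‖w - z‖ ≤ 1 / ((n : ℝ) + 1) * ((n + 1 : ℕ) * y / 2) := by gcongr
        _ = y / 2 := by push_cast; field_simp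
        _ ≤ v.im / 2 := by linarith
    obtain ⟨hd1, -, hg1⟩ := distortion_upperHalfPlane hf hinj (hy.trans_le hvim) hwv
    have hdv : ‖deriv f v‖ ≤ 12 ^ n * ‖deriv f z‖ := norm_deriv_le_pow_mul hf hinj hy n hz hvim hvz
    have hprev := ih hz hvim hzM hvM hvz
    have hM0 : 0 ≤ M := le_trans (le_trans hy.le hz) hzM
    have hfz : 0 ≤ ‖deriv f z‖ := norm_nonneg _
    have h12 : (1 : ℝ) ≤ 12 ^ n := one_le_pow₀ (by norm_num)
    calc ‖f w - f z‖ ≤ ‖f w - f v‖ + ‖f v - f z‖ := norm_sub_le_norm_sub_add_norm_sub _ _ _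
      _ ≤ 2 * v.im * ‖deriv f v‖ + 2 * M * n * 12 ^ n * ‖deriv f z‖ := add_le_add hg1 hprev
      _ ≤ 2 * M * (12 ^ n * ‖deriv f z‖) + 2 * M * n * 12 ^ n * ‖deriv f z‖ := by
          gcongr
      _ = 2 * M * (n + 1) * 12 ^ n * ‖deriv f z‖ := by ring
      _ ≤ 2 * M * (n + 1) * 12 ^ (n + 1) * ‖deriv f z‖ := by
          have : (12 : ℝ) ^ n ≤ 12 ^ (n + 1) := pow_le_pow_right₀ (by norm_num) (Nat.le_succ n)
          have h2 : 0 ≤ 2 * M * ((n : ℝ) + 1) := by positivity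
          nlinarith [mul_nonneg h2 hfz]
      _ = 2 * M * ((n + 1 : ℕ) : ℝ) * 12 ^ (n + 1) * ‖deriv f z‖ := by push_cast; ring

/-! ### A Schwarz–Pick type bound for holomorphic maps into the half-plane -/

/-- **`|f'(z)| ≤ 2 im f(z) / im z`** for `f` holomorphic on `ℍₒ` with values in `ℍₒ` (Schwarz's
lemma for `T ∘ f` on the disc `B(z, im z)`, where `T(w) = (w - a)/(w - ā)`, `a = f(z)`, maps
`ℍₒ` into the unit disc with `|T'(a)| = 1/(2 im a)`; the sharp constant `1` would need the whole
half-plane as domain). [folklore] -/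
theorem norm_deriv_le_two_mul_im_div (hf : DifferentiableOn ℂ f upperHalfPlaneSet)
    (hmaps : MapsTo f upperHalfPlaneSet upperHalfPlaneSet) {z : ℂ} (hz : 0 < z.im) :
    ‖deriv f z‖ ≤ 2 * (f z).im / z.im := by
  set a : ℂ := f z with ha
  have ha0 : 0 < a.im := hmaps hz
  -- the Möbius map `T w = (w - a)/(w - conj a)`
  set T : ℂ → ℂ := fun w ↦ (w - a) / (w - (starRingEnd ℂ) a) with hT
  have hden : ∀ w : ℂ, 0 < w.im → w - (starRingEnd ℂ) a ≠ 0 := fun w hw h ↦ by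
    have := congrArg Complex.im h
    simp only [Complex.sub_im, Complex.conj_im, Complex.zero_im] at this
    linarith
  have hTmaps : MapsTo T upperHalfPlaneSet (ball 0 1) := fun w hw ↦ by
    have hw0 : 0 < w.im := hw
    rw [mem_ball_zero_iff, hT]
    simp only
    rw [norm_div, div_lt_one (norm_pos_iff.2 (hden w hw0))]
    rw [← sq_lt_sq₀ (norm_nonneg _) (norm_nonneg _), ← Complex.normSq_eq_norm_sq,
      ← Complex.normSq_eq_norm_sq, Complex.normSq_apply, Complex.normSq_apply]
    simp only [Complex.sub_re, Complex.sub_im, Complex.conj_re, Complex.conj_im]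
    nlinarith
  have hTd : ∀ w : ℂ, 0 < w.im → HasDerivAt T
      ((1 * (w - (starRingEnd ℂ) a) - (w - a) * 1) / (w - (starRingEnd ℂ) a) ^ 2) w := fun w hw ↦
    ((hasDerivAt_id w).sub_const a).div ((hasDerivAt_id w).sub_const _) (hden w hw)
  have hballH := ball_im_subset_upperHalfPlaneSet z
  -- Schwarz's lemma for `T ∘ f` on `B(z, im z)`
  have hcomp_d : DifferentiableOn ℂ (T ∘ f) (ball z z.im) := by
    intro w hw
    have hfw : DifferentiableAt ℂ f w := hf.differentiableAt (isOpen_upperHalfPlaneSet.mem_nhds (hballH hw))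
    exact ((hTd (f w) (hmaps (hballH hw))).differentiableAt.comp w hfw).differentiableWithinAt
  have hT0 : (T ∘ f) z = 0 := by simp [hT, ha]
  have hcomp_maps : MapsTo (T ∘ f) (ball z z.im) (closedBall ((T ∘ f) z) 1) := fun w hw ↦ by
    rw [hT0]
    exact ball_subset_closedBall (hTmaps (hmaps (hballH hw)))
  have hS := Complex.norm_deriv_le_div_of_mapsTo_ball hcomp_d hcomp_maps hz
  -- `(T ∘ f)'(z) = T'(a) f'(z)` with `|T'(a)| = 1/(2 im a)`
  have hTa : HasDerivAt T ((1 * (a - (starRingEnd ℂ) a) - (a - a) * 1) / (a - (starRingEnd ℂ) a) ^ 2) a :=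
    hTd a ha0
  have hfz : HasDerivAt f (deriv f z) z := (hf.differentiableAt (isOpen_upperHalfPlaneSet.mem_nhds hz)).hasDerivAt
  have hchain := hTa.comp z hfz
  rw [hchain.deriv, norm_mul] at hS
  have hTa_norm : ‖(1 * (a - (starRingEnd ℂ) a) - (a - a) * 1) / (a - (starRingEnd ℂ) a) ^ 2‖ = 1 / (2 * a.im) := by
    have hsub : a - (starRingEnd ℂ) a = (2 * a.im : ℝ) * I := by
      apply Complex.ext
      · simp
      · simp; ring
    rw [sub_self, zero_mul, sub_zero, one_mul, hsub]
    rw [norm_div, norm_pow, norm_mul, Complex.norm_real, Complex.norm_I, mul_one, Real.norm_eq_abs,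
      abs_of_pos (by positivity)]
    field_simp
  rw [hTa_norm] at hS
  -- `|f'(z)|/(2 im a) ≤ 1/im z`
  rw [div_mul_eq_mul_div, one_mul, div_le_div_iff₀ (by positivity) hz] at hS
  rw [le_div_iff₀ hz]
  linarith

end AreaThm

end Literature.Analysis.Complex
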